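import Summits.HubbardSuperconductivity.HubbardSuperconductivity.Theorems.AnisotropyChordTotalSpinTransfer

/-!
# Route `AnisotropyChord` / H0 rotor rung, route (1) «ODLRO transfer across sectors»: FIRST LINKS ⇒ CONDENSATE
# (port + proof of theory seat `hubbard-h0-rotor-theory-1`'s COROLLARY `FirstLinksGiveCondensate`, cycle 12 `PartE.lean`,
# memo ROTOR-THEORY-11 §175; the output end of THEOREM T in the H0 chain's currency `EventualCondensate`)

`FirstLinksUpTo Δ ε k` (XY-LM₀(ε) on the first `k` links above half filling), `CondensateOnFirstSectors Δ k`
(`EventualCondensate` along the constant sector sequences `M_L = j`, `j ≤ k`) and `FirstLinksGiveCondensate` VERBATIM from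
PartE.lean, and the PROOF `firstLinksGiveCondensate_holds`: `totalSpinSq a j = ‖S⁻a‖² + j² − j`, `totalSpinSq a₀ 0 = ‖S⁻a₀‖² ≥ c₀|V|²`
(anchor), so the first-links inequality gives `condensateDensity a ≥ c₀ − ε − j²/|V|² ≥ (c₀ − ε)/2` eventually.
-/

set_option linter.dupNamespace false
set_option autoImplicit false

noncomputable section

open Finset Filter Topology
open Literature.MathematicalPhysics.QuantumLattice Literature.Probability.LatticeModels
open Summit.HubbardSuperconductivity.HubbardSuperconductivity.Theorems.AnisotropyChord.InsertionEntropy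
open Summit.HubbardSuperconductivity.HubbardSuperconductivity.Theorems.AnisotropyChord.Tower

namespace Summit.HubbardSuperconductivity.HubbardSuperconductivity.Theorems.AnisotropyChord.Transfer

/-- Conclusion shape: XY-LM₀(ε) on the first `k` links above half filling (below: spin flip).
(VERBATIM port of the theory seat's `FirstLinksUpTo`, PartE.lean.)
[conjecture: theory seat hubbard-h0-rotor-theory-1, cycle 12 — target-side statement] -/
def FirstLinksUpTo (Δ ε : ℝ) (k : ℕ) : Prop :=
  ∀ᶠ L : ℕ in atTop, ∀ [NeZero L], ∀ j : ℕ, j ≤ k →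
    ∀ a₀ a : TensorIndex (TorusSite 2 L) 2 → ℝ,
      IsPerronSectorGroundAmplitude L Δ 0 a₀ → IsPerronSectorGroundAmplitude L Δ (j : ℝ) a →
        Summit.HubbardSuperconductivity.HubbardSuperconductivity.Theorems.AnisotropyChord.Tower.totalSpinSq a₀ 0
          - ε * (Fintype.card (TorusSite 2 L) : ℝ) ^ 2
        ≤ Summit.HubbardSuperconductivity.HubbardSuperconductivity.Theorems.AnisotropyChord.Tower.totalSpinSq a (j : ℝ)

/-- BEC in each of the first `k` sectors above half filling, in the currency of the H0 chain
(`EventualCondensate Δ M` along the CONSTANT sector sequences `M_L = j`, `j ≤ k`; KLS = the case `j = 0`).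
(VERBATIM port of the theory seat's `CondensateOnFirstSectors`, PartE.lean.)
[conjecture: theory seat hubbard-h0-rotor-theory-1, cycle 12 — target-side statement] -/
def CondensateOnFirstSectors (Δ : ℝ) (k : ℕ) : Prop :=
  ∀ j : ℕ, j ≤ k → EventualCondensate Δ (fun _ => (j : ℝ))

/-- **COROLLARY (first links ⇒ condensate)** (VERBATIM port of the theory seat's `FirstLinksGiveCondensate`, PartE.lean):
`totalSpinSq a j = lowerNormSq a + j² − j`, `totalSpinSq a₀ 0 = lowerNormSq a₀ ≥ c₀|V|²` (anchor), so `FirstLinksUpTo Δ ε k` with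
`ε < c₀` gives `condensateDensity a ≥ c₀ − ε − j²/|V|² ≥ (c₀ − ε)/2` eventually.  (Needs the existence of the sector-0 Perron
amplitude for even `L`; for odd `L` every integer sector is empty.)
[conjecture: theory seat hubbard-h0-rotor-theory-1, cycle 12, memo §175 — PROVABLE bookkeeping; Lean proof below] -/
def FirstLinksGiveCondensate : Prop :=
  ∀ (Δ ε c₀ : ℝ) (k : ℕ), 0 < ε → ε < c₀ →
    HalfFillingAnchor Δ c₀ →
    (∀ᶠ L : ℕ in atTop, ∀ [NeZero L], Even L →
        ∃ a₀ : TensorIndex (TorusSite 2 L) 2 → ℝ, IsPerronSectorGroundAmplitude L Δ 0 a₀) →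
    (∀ᶠ L : ℕ in atTop, ∀ [NeZero L], ¬ Even L → ∀ (j : ℕ) (a : TensorIndex (TorusSite 2 L) 2 → ℝ),
        ¬ IsPerronSectorGroundAmplitude L Δ (j : ℝ) a) →
    FirstLinksUpTo Δ ε k → CondensateOnFirstSectors Δ k

/-- **THE COROLLARY HOLDS.** [conjecture: theory seat hubbard-h0-rotor-theory-1, cycle 12 — COROLLARY; Lean proof here] -/
theorem firstLinksGiveCondensate_holds : FirstLinksGiveCondensate := by
  intro Δ ε c₀ k hε hεc hA hexist hodd hlinks j hj
  refine ⟨(c₀ - ε) / 2, by linarith, ?_⟩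
  -- `L` large: `j² ≤ ((c₀ − ε)/2)·L⁴`
  have hlarge : ∀ᶠ L : ℕ in atTop, (j : ℝ) ^ 2 ≤ (c₀ - ε) / 2 * ((L : ℝ) ^ 2) ^ 2 := by
    have ht : Tendsto (fun L : ℕ => (c₀ - ε) / 2 * ((L : ℝ) ^ 2) ^ 2) atTop atTop := by
      apply Tendsto.const_mul_atTop (by linarith)
      have h4 : (fun L : ℕ => ((L : ℝ) ^ 2) ^ 2) = fun L : ℕ => (L : ℝ) ^ 4 := by funext L; ring
      rw [h4]
      exact (tendsto_pow_atTop (by norm_num)).comp tendsto_natCast_atTop_atTop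
    exact ht.eventually_ge_atTop _
  filter_upwards [hA, hexist, hodd, hlinks, hlarge] with L hAL hexL hoddL hlinkL hlargeL
  intro _ a ha
  have hW : (Fintype.card (TorusSite 2 L) : ℝ) = (L : ℝ) ^ 2 := by
    rw [Fintype.card_fun, ZMod.card, Fintype.card_fin]; push_cast; ring
  by_cases hev : Even L
  · obtain ⟨a₀, ha₀⟩ := hexL hev
    have h1 := hlinkL j hj a₀ a ha₀ ha
    have hanchor : c₀ ≤ condensateDensity a₀ := hAL a₀ ha₀
    have hL1 : (1 : ℝ) ≤ L := by exact_mod_cast Nat.one_le_iff_ne_zero.mpr (NeZero.ne L)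
    have hVpos : 0 < (Fintype.card (TorusSite 2 L) : ℝ) ^ 2 := by rw [hW]; positivity
    have e0 : condensateDensity a₀ = lowerNormSq a₀ / (Fintype.card (TorusSite 2 L) : ℝ) ^ 2 := rfl
    have e1 : condensateDensity a = lowerNormSq a / (Fintype.card (TorusSite 2 L) : ℝ) ^ 2 := rfl
    rw [e0, le_div_iff₀ hVpos] at hanchor
    rw [e1, le_div_iff₀ hVpos]
    unfold Summit.HubbardSuperconductivity.HubbardSuperconductivity.Theorems.AnisotropyChord.Tower.totalSpinSq at h1
    rw [hW] at hanchor h1 ⊢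
    have hj0 : (0 : ℝ) ≤ j := Nat.cast_nonneg _
    nlinarith [h1, hanchor, hlargeL, hj0]
  · exact absurd ha (hoddL hev j a)

end Summit.HubbardSuperconductivity.HubbardSuperconductivity.Theorems.AnisotropyChord.Transfer
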